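import Summits.AtomisticToContinuum.HydrodynamicLimit.Theorems.CollisionIsometryCLTMacroClosureRuelleMaster
import Summits.AtomisticToContinuum.HydrodynamicLimit.Theorems.CollisionIsometryCLTMacroClosureRuelleEstimate
import Summits.AtomisticToContinuum.HydrodynamicLimit.Theorems.CollisionIsometryCLTMacroClosureFvBccLower
import Summits.AtomisticToContinuum.HydrodynamicLimit.Theorems.CollisionIsometryCLTMacroClosureFvMixingParams
import Summits.AtomisticToContinuum.HydrodynamicLimit.Theorems.CollisionIsometryCLTHsFreeEnergyConvexTransport
import HarnessLib

/-!
# Ruelle convexity of the hard-sphere free-energy density for the tree's `limsup` object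

Lead file of the line `IdeatorTwoGen1Sketch` for the crux `MacroClosure` (stmt-AtomisticToContinuum-14870):
the registered stub

`stub_ruelleConvexity : ConvexOn ℝ (Ioo 0 (11/10)) (fun η => η * Real.log η + η * hsExcessFreeEnergy η)`

(Ruelle 1969, Thm 3.4.4, for `hsExcessFreeEnergy η = limsup_N (−N⁻¹ log hsFreeVolume η N)`), and with it
the statics input `stub_hsFreeEnergyConvex : StiffCollisionalRelaxation.HsFreeEnergyConvex` of the line
(= item stmt-AtomisticToContinuum-9526, by the landed transport lemma
`HsFreeEnergyConvex.hsFreeEnergyConvex_of_convexOn'`).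

Proof. For `0 < η₁ < η₂ < 11/10`, `0 < α < 1`, `η = αη₁ + (1−α)η₂` and every `ε ∈ (0,1]`: for all large
`N` the bookkeeping `fv_mixing_params` (cells at densities `≤ η₁`, `≤ η₂`, one fractional, one overflow
cell) feeds the master inequality of the sub-cube decomposition (`RuelleMaster.master`) and its Stirling
bookkeeping (`RuelleEstimate.rate_le`); the cell rates are eventually `≤ f(ηᵢ) + ε` (`limsup`) or `≤ C`
(the body-centred-cubic a-priori bound `fv_bcc_lower`, which also makes every free volume positive), the
mixing weights are within `ε` of `αη₁/η`, `(1−α)η₂/η`, and the special cells carry `≤ εN` particles.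
Hence `a_N(η) ≤ (αη₁/η)(log(η₁/η) + f(η₁)) + ((1−α)η₂/η)(log(η₂/η) + f(η₂)) + εK` eventually, so the same
bound holds for `f(η) = limsup a_N(η)`; `ε → 0` and multiplication by `η` give
`η log η + η f(η) ≤ α(η₁ log η₁ + η₁ f(η₁)) + (1−α)(η₂ log η₂ + η₂ f(η₂))`.

Reference: D. Ruelle, *Statistical Mechanics: Rigorous Results* (1969), §3.4, Thm 3.4.4.
-/

noncomputable section

open MeasureTheory Filter Set Topology
open scoped ENNReal

namespace Summit.AtomisticToContinuum.HydrodynamicLimit.Theorems.MacroClosureLine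

open Literature.MathematicalPhysics.KineticTheory Literature.Analysis.FluidPDE
open Literature.Analysis.FunctionSpaces
open Summit.AtomisticToContinuum.HydrodynamicLimit.Theses

namespace Barycentric

namespace RuelleConvexity

/-- **A-priori bound** (from the body-centred-cubic bound): there are `C ≥ 0` and `N₀ ≥ 1` such that for
`N ≥ N₀` and every density `0 ≤ η' ≤ 6/5` the free volume is positive and the rate is `≤ C`. -/
theorem apriori : ∃ C : ℝ, 0 ≤ C ∧ ∃ N₀ : ℕ, 1 ≤ N₀ ∧ ∀ N : ℕ, N₀ ≤ N → ∀ η' : ℝ, 0 ≤ η' → η' ≤ 6 / 5 →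
    0 < hsFreeVolume η' N ∧ -(N : ℝ)⁻¹ * Real.log (hsFreeVolume η' N) ≤ C := by
  obtain ⟨C₀, N₀, h⟩ := fv_bcc_lower
  refine ⟨max C₀ 0, le_max_right _ _, max N₀ 1, le_max_right _ _, fun N hN η' hη' hη'le => ?_⟩
  have hN₀ : N₀ ≤ N := le_trans (le_max_left _ _) hN
  have hN1 : 0 < N := lt_of_lt_of_le Nat.one_pos (le_trans (le_max_right _ _) hN)
  have hexp : Real.exp (-(max C₀ 0 * N)) ≤ hsFreeVolume (6 / 5) N := by
    refine le_trans (Real.exp_le_exp.2 ?_) (h N hN₀)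
    have : C₀ * N ≤ max C₀ 0 * N := mul_le_mul_of_nonneg_right (le_max_left _ _) (Nat.cast_nonneg N)
    linarith
  have hpos65 : 0 < hsFreeVolume (6 / 5) N := (Real.exp_pos _).trans_le hexp
  have hpos : 0 < hsFreeVolume η' N :=
    hpos65.trans_le (HsFreeEnergyConvex.hsFreeVolume_anti hη' hη'le N)
  exact ⟨hpos, (HsFreeEnergyConvex.rate_le_rate_of_pos hη' hη'le hpos65).trans
    (HsFreeEnergyConvex.rate_le_of_exp_le hN1 hexp)⟩

/-- Elementary: `x M ≤ p (L + f) + ε (p + |L| + f + 1)` when `|x − p| ≤ ε`, `0 ≤ x`, `M ≤ L + f + ε'`-type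
bookkeeping — here in the exact form used below: `0 ≤ x`, `|x − p| ≤ ε`, `a ≤ f + ε`, `0 ≤ f`,
`0 < ε ≤ 1` give `x (L + a) ≤ p (L + f) + ε (p + |L| + f + 1)`. -/
theorem weight_term_le {x p L a f ε : ℝ} (hx : 0 ≤ x) (hxp : |x - p| ≤ ε) (ha : a ≤ f + ε)
    (hf : 0 ≤ f) (hε : 0 < ε) (hε1 : ε ≤ 1) :
    x * (L + a) ≤ p * (L + f) + ε * (p + |L| + f + 1) := by
  have h1 : x * (L + a) ≤ x * (L + f + ε) := by nlinarith
  have h2 : x * (L + f + ε) - p * (L + f + ε) ≤ ε * (|L| + f + 1) := by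
    have : x * (L + f + ε) - p * (L + f + ε) = (x - p) * (L + f + ε) := by ring
    rw [this]
    calc (x - p) * (L + f + ε) ≤ |(x - p) * (L + f + ε)| := le_abs_self _
      _ = |x - p| * |L + f + ε| := abs_mul _ _
      _ ≤ ε * (|L| + f + 1) := by
          refine mul_le_mul hxp ?_ (abs_nonneg _) hε.le
          calc |L + f + ε| ≤ |L| + |f + ε| := by
                simpa [add_assoc] using abs_add_le L (f + ε)
            _ ≤ |L| + f + 1 := by rw [abs_of_nonneg (show (0 : ℝ) ≤ f + ε by linarith)]; linarith
  nlinarith [h1, h2]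

/-- **The eventual rate bound.** For `ε ∈ (0,1]`, eventually in `N`,
`a_N(η) ≤ p₁ (log(η₁/η) + f η₁) + p₂ (log(η₂/η) + f η₂) + ε K`. [cite: Ruelle1969, §3.4] -/
theorem eventually_rate_le (η₁ η₂ α : ℝ) (h₁ : 0 < η₁) (h₁₂ : η₁ < η₂) (h₂ : η₂ < 11 / 10)
    (hα : 0 < α) (hα₁ : α < 1) {C : ℝ} (hC : 0 ≤ C) {N₀ : ℕ} (hN₀ : 1 ≤ N₀)
    (hap : ∀ N : ℕ, N₀ ≤ N → ∀ η' : ℝ, 0 ≤ η' → η' ≤ 6 / 5 →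
      0 < hsFreeVolume η' N ∧ -(N : ℝ)⁻¹ * Real.log (hsFreeVolume η' N) ≤ C)
    {ε : ℝ} (hε : 0 < ε) (hε1 : ε ≤ 1) :
    ∀ᶠ N : ℕ in atTop,
      -(N : ℝ)⁻¹ * Real.log (hsFreeVolume (α * η₁ + (1 - α) * η₂) N) ≤
        α * η₁ / (α * η₁ + (1 - α) * η₂) *
            (Real.log (η₁ / (α * η₁ + (1 - α) * η₂)) + hsExcessFreeEnergy η₁) +
          (1 - α) * η₂ / (α * η₁ + (1 - α) * η₂) *
            (Real.log (η₂ / (α * η₁ + (1 - α) * η₂)) + hsExcessFreeEnergy η₂) +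
          ε * (α * η₁ / (α * η₁ + (1 - α) * η₂) + |Real.log (η₁ / (α * η₁ + (1 - α) * η₂))| +
              hsExcessFreeEnergy η₁ + 1 +
            ((1 - α) * η₂ / (α * η₁ + (1 - α) * η₂) + |Real.log (η₂ / (α * η₁ + (1 - α) * η₂))| +
              hsExcessFreeEnergy η₂ + 1) +
            (Real.log (η₂ / (α * η₁ + (1 - α) * η₂)) + C) + (Real.log 2 + C) + 1) := by
  set η : ℝ := α * η₁ + (1 - α) * η₂ with hηdef
  have hgap : 0 < (1 - α) * (η₂ - η₁) := mul_pos (by linarith) (by linarith)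
  have hgap' : 0 < α * (η₂ - η₁) := mul_pos hα (by linarith)
  have hη₁η : η₁ < η := by rw [hηdef]; linarith
  have hηη₂ : η < η₂ := by rw [hηdef]; linarith
  have hη0 : 0 < η := h₁.trans hη₁η
  have hη₂0 : 0 < η₂ := h₁.trans h₁₂
  have h65₁ : η₁ ≤ 6 / 5 := by linarith
  have h65₂ : η₂ ≤ 6 / 5 := by linarith
  -- eventual rate bounds at η₁, η₂ (limsup is not a junk value under the a-priori bound)
  have hb : ∀ η' : ℝ, 0 ≤ η' → η' ≤ 6 / 5 →
      ∀ᶠ n : ℕ in atTop, -(n : ℝ)⁻¹ * Real.log (hsFreeVolume η' n) ≤ C := fun η' h0 h65 =>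
    Filter.eventually_atTop.2 ⟨N₀, fun n hn => (hap n hn η' h0 h65).2⟩
  have hev₁ := HsFreeEnergyConvex.eventually_rate_le_add (hb η₁ h₁.le h65₁) hε
  have hev₂ := HsFreeEnergyConvex.eventually_rate_le_add (hb η₂ hη₂0.le h65₂) hε
  obtain ⟨N₁, hN₁⟩ := Filter.eventually_atTop.1 ((hev₁.and hev₂).and (Filter.eventually_ge_atTop N₀))
  -- the bookkeeping, for all large N
  have hmix := fv_mixing_params η₁ η₂ α h₁ h₁₂ h₂ hα hα₁ N₁ ε hε
  filter_upwards [hmix, Filter.eventually_ge_atTop 1] with N hN hN1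
  obtain ⟨k, J₁, J₂, n₁, n₂, n₄, R, s, hs, hk, hs0, hkJ, hsum, hn₁, hn₂, hn₄, hR, hd₁, hd₂, hd₄, hdR,
    hR2, hn₄ε, hRε, hx₁, hx₂, hk3⟩ := hN
  -- thresholds
  have hN₁n₁ := hN₁ n₁ hn₁
  have hN₁n₂ := hN₁ n₂ hn₂
  have hN₀n₄ : N₀ ≤ n₄ := (hN₁ n₄ hn₄).2
  have hN₀R : N₀ ≤ R := (hN₁ R hR).2
  have hF₁ : 0 < hsFreeVolume η₁ n₁ := (hap n₁ hN₁n₁.2 η₁ h₁.le h65₁).1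
  have hF₂ : 0 < hsFreeVolume η₂ n₂ := (hap n₂ hN₁n₂.2 η₂ hη₂0.le h65₂).1
  have hF₄ : 0 < hsFreeVolume η₂ n₄ := (hap n₄ hN₀n₄ η₂ hη₂0.le h65₂).1
  have hFR : 0 < hsFreeVolume (6 / 5) R := (hap R hN₀R (6 / 5) (by norm_num) le_rfl).1
  have ha₁ : -(n₁ : ℝ)⁻¹ * Real.log (hsFreeVolume η₁ n₁) ≤ hsExcessFreeEnergy η₁ + ε := hN₁n₁.1.1
  have ha₂ : -(n₂ : ℝ)⁻¹ * Real.log (hsFreeVolume η₂ n₂) ≤ hsExcessFreeEnergy η₂ + ε := hN₁n₂.1.2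
  have ha₄ : -(n₄ : ℝ)⁻¹ * Real.log (hsFreeVolume η₂ n₄) ≤ C := (hap n₄ hN₀n₄ η₂ hη₂0.le h65₂).2
  have haR : -(R : ℝ)⁻¹ * Real.log (hsFreeVolume (6 / 5) R) ≤ C :=
    (hap R hN₀R (6 / 5) (by norm_num) le_rfl).2
  have hn₁0 : n₁ ≠ 0 := by omega
  have hn₂0 : n₂ ≠ 0 := by omega
  have hn₄0 : n₄ ≠ 0 := by omega
  have hR0 : R ≠ 0 := by omega
  have hNpos : 0 < N := hN1
  have hN0 : (0 : ℝ) < N := by exact_mod_cast hNpos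
  -- the master inequality and its Stirling bookkeeping
  have hmaster := RuelleMaster.master η η₁ η₂ N k J₁ J₂ n₁ n₂ n₄ R s hη0 hNpos hs hk hs0
    hkJ hsum hd₁ hd₂ hd₄ hdR
  have hrate := RuelleEstimate.rate_le η η₁ η₂ s (hsFreeVolume η₁ n₁) (hsFreeVolume η₂ n₂)
    (hsFreeVolume η₂ n₄) (hsFreeVolume (6 / 5) R) (hsFreeVolume η N) N k J₁ J₂ n₁ n₂ n₄ R hη0 hs0 hF₁
    hF₂ hF₄ hFR hkJ hsum hn₁0 hn₂0 hn₄0 hR0 hd₁ hd₂ hd₄ hR2 hmaster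
  -- the five terms
  have hf₁ := HsFreeEnergyConvex.hsExcessFreeEnergy_nonneg η₁
  have hf₂ := HsFreeEnergyConvex.hsExcessFreeEnergy_nonneg η₂
  have hT₁ := weight_term_le (L := Real.log (η₁ / η)) (by positivity) hx₁ ha₁ hf₁ hε hε1
  have hT₂ := weight_term_le (L := Real.log (η₂ / η)) (by positivity) hx₂ ha₂ hf₂ hε hε1
  have hlog₂ : 0 ≤ Real.log (η₂ / η) := Real.log_nonneg (by rw [le_div_iff₀ hη0]; linarith)
  have hra₄ := HsFreeEnergyConvex.rate_nonneg η₂ n₄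
  have hraR := HsFreeEnergyConvex.rate_nonneg (6 / 5) R
  have hx₄ : (n₄ : ℝ) / N ≤ ε := by rw [div_le_iff₀ hN0]; exact hn₄ε
  have hxR : (R : ℝ) / N ≤ ε := by rw [div_le_iff₀ hN0]; exact hRε
  have hT₄ : (n₄ : ℝ) / N * (Real.log (η₂ / η) + -(n₄ : ℝ)⁻¹ * Real.log (hsFreeVolume η₂ n₄)) ≤
      ε * (Real.log (η₂ / η) + C) := by
    have h0 : (0 : ℝ) ≤ (n₄ : ℝ) / N := by positivity
    calc (n₄ : ℝ) / N * (Real.log (η₂ / η) + -(n₄ : ℝ)⁻¹ * Real.log (hsFreeVolume η₂ n₄))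
        ≤ (n₄ : ℝ) / N * (Real.log (η₂ / η) + C) := by gcongr
      _ ≤ ε * (Real.log (η₂ / η) + C) := by gcongr
  have hTR : (R : ℝ) / N * (Real.log 2 + -(R : ℝ)⁻¹ * Real.log (hsFreeVolume (6 / 5) R)) ≤
      ε * (Real.log 2 + C) := by
    have h0 : (0 : ℝ) ≤ (R : ℝ) / N := by positivity
    have hl2 : (0 : ℝ) ≤ Real.log 2 := Real.log_nonneg (by norm_num)
    calc (R : ℝ) / N * (Real.log 2 + -(R : ℝ)⁻¹ * Real.log (hsFreeVolume (6 / 5) R))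
        ≤ (R : ℝ) / N * (Real.log 2 + C) := by gcongr
      _ ≤ ε * (Real.log 2 + C) := by gcongr
  have hTk : (k : ℝ) ^ 3 * (1 + Real.log N / 2) / N ≤ ε := by
    rw [div_le_iff₀ hN0]
    have e3 : (k : ℝ) ^ 3 * (1 + Real.log N / 2) = (k : ℝ) ^ 3 * (Real.log N + 2) / 2 := by ring
    have hεN : 0 ≤ ε * N := by positivity
    rw [e3]
    linarith [hk3]
  linarith [hrate, hT₁, hT₂, hT₄, hTR, hTk]

/-- `a ≤ b` from `a ≤ b + ε K` for all `ε ∈ (0, 1]` (`K ≥ 0`). -/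
theorem le_of_forall_eps {a b K : ℝ} (hK : 0 ≤ K) (h : ∀ ε : ℝ, 0 < ε → ε ≤ 1 → a ≤ b + ε * K) : a ≤ b := by
  refine le_of_forall_pos_le_add fun δ hδ => ?_
  have hε : 0 < min 1 (δ / (K + 1)) := lt_min one_pos (div_pos hδ (by linarith))
  have := h _ hε (min_le_left _ _)
  have hb : min 1 (δ / (K + 1)) * K ≤ δ := by
    calc min 1 (δ / (K + 1)) * K ≤ δ / (K + 1) * K :=
          mul_le_mul_of_nonneg_right (min_le_right _ _) hK
      _ ≤ δ := by
          rw [div_mul_eq_mul_div, div_le_iff₀ (by linarith)]; nlinarith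
  linarith

/-- **The convexity inequality at interior weights.** For `0 < η₁ < η₂ < 11/10` and `0 < α < 1`,
`h(αη₁ + (1−α)η₂) ≤ α h(η₁) + (1−α) h(η₂)` for `h(η) = η log η + η f_ex(η)`. [cite: Ruelle1969, Thm 3.4.4] -/
theorem core (η₁ η₂ α : ℝ) (h₁ : 0 < η₁) (h₁₂ : η₁ < η₂) (h₂ : η₂ < 11 / 10) (hα : 0 < α) (hα₁ : α < 1) :
    (α * η₁ + (1 - α) * η₂) * Real.log (α * η₁ + (1 - α) * η₂) +
        (α * η₁ + (1 - α) * η₂) * hsExcessFreeEnergy (α * η₁ + (1 - α) * η₂) ≤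
      α * (η₁ * Real.log η₁ + η₁ * hsExcessFreeEnergy η₁) +
        (1 - α) * (η₂ * Real.log η₂ + η₂ * hsExcessFreeEnergy η₂) := by
  obtain ⟨C, hC, N₀, hN₀, hap⟩ := apriori
  set η : ℝ := α * η₁ + (1 - α) * η₂ with hηdef
  have hgap : 0 < (1 - α) * (η₂ - η₁) := mul_pos (by linarith) (by linarith)
  have hgap' : 0 < α * (η₂ - η₁) := mul_pos hα (by linarith)
  have hη₁η : η₁ < η := by rw [hηdef]; linarith
  have hηη₂ : η < η₂ := by rw [hηdef]; linarith
  have hη0 : 0 < η := h₁.trans hη₁η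
  have hη₂0 : 0 < η₂ := h₁.trans h₁₂
  set p₁ : ℝ := α * η₁ / η with hp₁
  set p₂ : ℝ := (1 - α) * η₂ / η with hp₂
  set L₁ : ℝ := Real.log (η₁ / η) with hL₁
  set L₂ : ℝ := Real.log (η₂ / η) with hL₂
  set K : ℝ := p₁ + |L₁| + hsExcessFreeEnergy η₁ + 1 + (p₂ + |L₂| + hsExcessFreeEnergy η₂ + 1) +
    (L₂ + C) + (Real.log 2 + C) + 1 with hK
  have hp₁0 : 0 ≤ p₁ := by positivity
  have hp₂0 : 0 ≤ p₂ := div_nonneg (mul_nonneg (by linarith) hη₂0.le) hη0.le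
  have hf₁ := HsFreeEnergyConvex.hsExcessFreeEnergy_nonneg η₁
  have hf₂ := HsFreeEnergyConvex.hsExcessFreeEnergy_nonneg η₂
  have hL₂0 : 0 ≤ L₂ := Real.log_nonneg (by rw [le_div_iff₀ hη0]; linarith)
  have hK0 : 0 ≤ K := by
    have : (0 : ℝ) ≤ Real.log 2 := Real.log_nonneg (by norm_num)
    positivity
  -- the bound on f(η)
  have hfη : hsExcessFreeEnergy η ≤ p₁ * (L₁ + hsExcessFreeEnergy η₁) + p₂ * (L₂ + hsExcessFreeEnergy η₂) := by
    refine le_of_forall_eps hK0 fun ε hε hε1 => ?_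
    exact HsFreeEnergyConvex.hsExcessFreeEnergy_le_of_eventually_le
      (eventually_rate_le η₁ η₂ α h₁ h₁₂ h₂ hα hα₁ hC hN₀ hap hε hε1)
  -- multiply by η and rearrange
  have hmul := mul_le_mul_of_nonneg_left hfη hη0.le
  have e₁ : η * (p₁ * (L₁ + hsExcessFreeEnergy η₁)) =
      α * η₁ * (Real.log η₁ - Real.log η + hsExcessFreeEnergy η₁) := by
    rw [hp₁, hL₁, Real.log_div h₁.ne' hη0.ne']; field_simp
  have e₂ : η * (p₂ * (L₂ + hsExcessFreeEnergy η₂)) =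
      (1 - α) * η₂ * (Real.log η₂ - Real.log η + hsExcessFreeEnergy η₂) := by
    rw [hp₂, hL₂, Real.log_div hη₂0.ne' hη0.ne']; field_simp
  rw [mul_add, e₁, e₂] at hmul
  have hsplit : η * Real.log η = α * η₁ * Real.log η + (1 - α) * η₂ * Real.log η := by
    rw [hηdef]; ring
  nlinarith [hmul, hsplit]

end RuelleConvexity

/-- **Ruelle convexity** (registered stub `stub_ruelleConvexity` of the line `IdeatorTwoGen1Sketch`): the
configurational free-energy density `η ↦ η log η + η f_ex(η)` of the hard-sphere gas, for the tree's
`limsup` object `f_ex = hsExcessFreeEnergy`, is convex below packing `11/10`. [cite: Ruelle1969, Thm 3.4.4] -/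
theorem stub_ruelleConvexity :
    ConvexOn ℝ (Ioo (0 : ℝ) (11 / 10)) (fun η : ℝ => η * Real.log η + η * hsExcessFreeEnergy η) := by
  refine ⟨convex_Ioo 0 (11 / 10), ?_⟩
  intro x hx y hy a b ha hb hab
  simp only [smul_eq_mul]
  rcases lt_trichotomy x y with hxy | hxy | hxy
  · rcases ha.eq_or_lt with ha0 | ha0
    · subst ha0
      have hb1 : b = 1 := by linarith
      subst hb1; simp
    rcases hb.eq_or_lt with hb0 | hb0
    · subst hb0
      have ha1 : a = 1 := by linarith
      subst ha1; simp
    have hb' : b = 1 - a := by linarith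
    subst hb'
    exact RuelleConvexity.core x y a hx.1 hxy hy.2 ha0 (by linarith)
  · subst hxy
    have : a * x + b * x = x := by rw [← add_mul, hab, one_mul]
    rw [this, ← add_mul, hab, one_mul]
  · rcases hb.eq_or_lt with hb0 | hb0
    · subst hb0
      have ha1 : a = 1 := by linarith
      subst ha1; simp
    rcases ha.eq_or_lt with ha0 | ha0
    · subst ha0
      have hb1 : b = 1 := by linarith
      subst hb1; simp
    have ha' : a = 1 - b := by linarith
    subst ha'
    have h := RuelleConvexity.core y x b hy.1 hxy hx.2 hb0 (by linarith)
    have e1 : (1 - b) * x + b * y = b * y + (1 - b) * x := by ring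
    rw [e1]
    linarith [h]

/-- **Item stmt-AtomisticToContinuum-9526** (`HsFreeEnergyConvex`, the statics input
`stub_hsFreeEnergyConvex` of the line): for every `σ > 0`, minus the hard-sphere entropy density is convex
on the chamber `{0 < ρ, ρσ³ < 11/10, |m|² < 2ρE}` of conserved variables — from Ruelle convexity by the
landed transport (perspective) lemma `HsFreeEnergyConvex.hsFreeEnergyConvex_of_convexOn'`.
[cite: Dafermos2005, §5.2] -/
theorem stub_hsFreeEnergyConvex : StiffCollisionalRelaxation.HsFreeEnergyConvex :=
  HsFreeEnergyConvex.hsFreeEnergyConvex_of_convexOn' stub_ruelleConvexity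

end Barycentric

end Summit.AtomisticToContinuum.HydrodynamicLimit.Theorems.MacroClosureLine

end
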